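import Mathlib.MeasureTheory.Integral.Marginal
import Mathlib.MeasureTheory.Constructions.Pi
import HarnessLib

/-!
# Saturation along coordinate fibres of a finite product forces a.e. constancy (cube saturation lemma)

Cycle-2 tool (H3) of line `third-law-current-floor`, crux `BECConjugateDomination.HardCoreExtension`
(stmt-AtomisticToContinuum-11786): on a finite product `Π i, X i` of FINITE measure spaces, a measurable set `Z` such
that for every coordinate `i` and a.e. point `x` the `i`-fibre through `x` lies a.e. inside `Z` or a.e. outside `Z`
is null or conull for the product measure. Proof by the averaging operators `A_i g = (μ i univ)⁻¹ ∫ g(update x i ·)`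
(Mathlib's `lmarginal` over `{i}`): saturation gives `1_Z = A_i 1_Z` a.e., the `A_i` respect a.e. equality and
preserve integrals, so `1_Z = A_{i₁} ⋯ A_{iₙ} 1_Z = ⨍ 1_Z` a.e. (induction over a `Finset`, `lmarginal_insert`), and a
`{0,1}`-valued a.e. constant is `0` or `1` a.e.
-/

noncomputable section

namespace Summit.AtomisticToContinuum.BoseEinsteinCondensation.Cruxes.HardCoreExtension.ThirdLawCurrentFloorAlt

open MeasureTheory Filter Set Function
open scoped ENNReal

section CubeSaturation

variable {ι : Type*} [Fintype ι] [DecidableEq ι] {X : ι → Type*} [∀ i, MeasurableSpace (X i)]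
  (μ : ∀ i, Measure (X i)) [∀ i, IsFiniteMeasure (μ i)]

omit [Fintype ι] [∀ i, IsFiniteMeasure (μ i)] in
/-- Constants pull out of marginals of measurable functions. [folklore] -/
theorem lmarginal_const_mul (s : Finset ι) (c : ℝ≥0∞) {f : (∀ i, X i) → ℝ≥0∞} (hf : Measurable f) :
    lmarginal μ s (fun x => c * f x) = fun x => c * lmarginal μ s f x := by
  funext x
  simp only [lmarginal]
  exact lintegral_const_mul c (hf.comp measurable_updateFinset)

/-- Integrating a marginal over the product measure gives back the integral, up to the mass of the integrated
coordinate: `∫ (∫ F(update x i ·) dμᵢ) dP = μᵢ(univ) ∫ F dP`. [folklore] -/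
theorem lintegral_lmarginal_singleton (i : ι) {F : (∀ i, X i) → ℝ≥0∞} (hF : Measurable F) :
    ∫⁻ x, lmarginal μ {i} F x ∂Measure.pi μ = μ i univ * ∫⁻ x, F x ∂Measure.pi μ := by
  rcases isEmpty_or_nonempty (∀ i, X i) with h | ⟨⟨x₀⟩⟩
  · simp [lintegral_of_isEmpty]
  have hm : Measurable (lmarginal μ {i} F) := hF.lmarginal μ
  rw [lintegral_eq_lmarginal_univ (μ := μ) x₀, lintegral_eq_lmarginal_univ (μ := μ) x₀]
  have huniv : (Finset.univ : Finset ι) = insert i (Finset.univ.erase i) := by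
    rw [Finset.insert_erase (Finset.mem_univ i)]
  rw [huniv, lmarginal_insert' _ hm (Finset.notMem_erase i _), lmarginal_insert' _ hF (Finset.notMem_erase i _),
    ← lmarginal_singleton, ← lmarginal_singleton]
  -- the inner marginal of a function constant in the coordinate `i`
  have hconst : lmarginal μ {i} (lmarginal μ {i} F) = fun x => μ i univ * lmarginal μ {i} F x := by
    funext x
    rw [lmarginal_singleton]
    simp only
    have h2 : ∀ y, lmarginal μ {i} F (Function.update x i y) = lmarginal μ {i} F x := fun y =>
      lmarginal_update_of_mem μ (Finset.mem_singleton_self i) F x y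
    simp_rw [h2, lintegral_const, mul_comm]
  rw [hconst]
  -- pull the constant out of the outer marginal
  rw [lmarginal_const_mul μ _ _ hm]

/-- **The averaging operator respects a.e. equality**: if `g = h` a.e. for the product measure then
`∫ g(update x i ·) dμᵢ = ∫ h(update x i ·) dμᵢ` for a.e. `x`. [folklore] -/
theorem lmarginal_singleton_congr_ae (i : ι) {g h : (∀ i, X i) → ℝ≥0∞} (hg : Measurable g) (hh : Measurable h)
    (hgh : g =ᵐ[Measure.pi μ] h) :
    lmarginal μ {i} g =ᵐ[Measure.pi μ] lmarginal μ {i} h := by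
  -- the indicator of the disagreement set has a.e. vanishing marginal
  set D : Set (∀ i, X i) := {x | g x ≠ h x} with hD
  have hDm : MeasurableSet D := (measurableSet_eq_fun hg hh).compl
  have hD0 : Measure.pi μ D = 0 := by
    have h := ae_iff.1 hgh
    simpa [hD] using h
  have hind : Measurable (D.indicator (1 : (∀ i, X i) → ℝ≥0∞)) := measurable_one.indicator hDm
  have hint : ∫⁻ x, lmarginal μ {i} (D.indicator 1) x ∂Measure.pi μ = 0 := by
    rw [lintegral_lmarginal_singleton μ i hind, lintegral_indicator_one hDm, hD0, mul_zero]
  have hae := (lintegral_eq_zero_iff (hind.lmarginal μ)).1 hint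
  filter_upwards [hae] with x hx
  rw [lmarginal_singleton] at hx
  rw [lmarginal_singleton, lmarginal_singleton]
  simp only [Pi.zero_apply] at hx
  have hm' : Measurable fun y => D.indicator (1 : (∀ i, X i) → ℝ≥0∞) (Function.update x i y) :=
    hind.comp (measurable_update _)
  rw [lintegral_eq_zero_iff hm'] at hx
  refine lintegral_congr_ae (hx.mono fun y hy => ?_)
  by_contra hne
  have : Function.update x i y ∈ D := hne
  simp [Set.indicator_of_mem this] at hy

omit [∀ i, IsFiniteMeasure (μ i)] in
/-- **Saturation in one coordinate is invariance under its averaging operator**: if for a.e. `x` the fibre value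
`g(update x i ·)` is a.e. equal to `g x`, then `∫ g(update x i ·) dμᵢ = μᵢ(univ) g x` a.e. [folklore] -/
theorem lmarginal_singleton_eq_of_saturated (i : ι) {g : (∀ i, X i) → ℝ≥0∞}
    (hsat : ∀ᵐ x ∂Measure.pi μ, ∀ᵐ y ∂μ i, g (Function.update x i y) = g x) :
    lmarginal μ {i} g =ᵐ[Measure.pi μ] fun x => μ i univ * g x := by
  filter_upwards [hsat] with x hx
  rw [lmarginal_singleton]
  simp only
  rw [lintegral_congr_ae hx, lintegral_const, mul_comm]

/-- **Induction over the coordinates**: if `g` is invariant (a.e.) under every averaging operator then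
`μ(S) · g = ∫⋯∫_S g` a.e. for every finite set `S` of coordinates, `μ(S) = ∏_{i∈S} μᵢ(univ)`. [folklore] -/
theorem prod_mul_ae_eq_lmarginal {g : (∀ i, X i) → ℝ≥0∞} (hg : Measurable g)
    (hsat : ∀ i, ∀ᵐ x ∂Measure.pi μ, ∀ᵐ y ∂μ i, g (Function.update x i y) = g x) (S : Finset ι) :
    (fun x => (∏ i ∈ S, μ i univ) * g x) =ᵐ[Measure.pi μ] lmarginal μ S g := by
  induction S using Finset.induction with
  | empty => exact Eventually.of_forall fun x => by simp
  | insert i S hi ih =>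
    -- `∫⋯∫_{insert i S} g = ∫ (∫⋯∫_S g)(update x i ·) dμᵢ`
    have hstep : lmarginal μ (insert i S) g = lmarginal μ {i} (lmarginal μ S g) := by
      funext x
      rw [lmarginal_insert _ hg hi, lmarginal_singleton]
    rw [hstep]
    -- replace the inner marginal by `μ(S) g` (a.e.), then use the saturation in `i`
    have hm1 : Measurable fun x => (∏ i ∈ S, μ i univ) * g x := hg.const_mul _
    have h1 := lmarginal_singleton_congr_ae μ i (hg.lmarginal μ) hm1 ih.symm
    have h2 := lmarginal_singleton_eq_of_saturated μ i (g := fun x => (∏ i ∈ S, μ i univ) * g x)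
      ((hsat i).mono fun x hx => hx.mono fun y hy => by simp only [hy])
    filter_upwards [h1, h2] with x hx1 hx2
    rw [hx1, hx2, Finset.prod_insert hi]
    ring

/-- **Cube saturation lemma.** On a finite product of finite measure spaces, a measurable function with values in
`[0, ∞]` that is a.e. invariant along every coordinate fibre (`g(update x i y) = g x` for a.e. `x`, a.e. `y`, every `i`)
is a.e. equal to the constant `(∏ᵢ μᵢ(univ))⁻¹ ∫ g` — provided the total mass is neither `0` nor `∞`. [folklore] -/
theorem ae_eq_const_of_saturated {g : (∀ i, X i) → ℝ≥0∞} (hg : Measurable g)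
    (hsat : ∀ i, ∀ᵐ x ∂Measure.pi μ, ∀ᵐ y ∂μ i, g (Function.update x i y) = g x)
    (h0 : (∏ i, μ i univ) ≠ 0) :
    g =ᵐ[Measure.pi μ] fun _ => (∏ i, μ i univ)⁻¹ * ∫⁻ x, g x ∂Measure.pi μ := by
  have htop : (∏ i, μ i univ) ≠ ⊤ := ENNReal.prod_ne_top fun i _ => measure_ne_top _ _
  rcases isEmpty_or_nonempty (∀ i, X i) with h | ⟨⟨x₀⟩⟩
  · exact Eventually.of_forall fun x => (h.false x).elim
  have h := prod_mul_ae_eq_lmarginal μ hg hsat Finset.univ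
  filter_upwards [h] with x hx
  have hxy : lmarginal μ Finset.univ g x₀ = lmarginal μ Finset.univ g x :=
    lmarginal_congr μ (s := Finset.univ) (x := x₀) (y := x) g (fun i hi => absurd (Finset.mem_univ i) hi)
  rw [lintegral_eq_lmarginal_univ (μ := μ) x₀, hxy, ← hx, ← mul_assoc, ENNReal.inv_mul_cancel h0 htop, one_mul]

/-- **Cube saturation for sets.** On a finite product of finite measure spaces with non-zero total mass, a measurable
set `Z` such that for every coordinate `i` and a.e. `x` the fibre `y ↦ update x i y` lies a.e. in `Z` or a.e. outside
`Z`, is null or conull. [folklore] -/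
theorem measure_eq_zero_or_compl_of_saturated {Z : Set (∀ i, X i)} (hZ : MeasurableSet Z)
    (hsat : ∀ i, ∀ᵐ x ∂Measure.pi μ,
      (∀ᵐ y ∂μ i, Function.update x i y ∈ Z) ∨ (∀ᵐ y ∂μ i, Function.update x i y ∉ Z)) :
    Measure.pi μ Z = 0 ∨ Measure.pi μ Zᶜ = 0 := by
  by_cases h0 : (∏ i, μ i univ) = 0
  · left
    have huniv : Measure.pi μ univ = 0 := by rw [Measure.pi_univ, h0]
    exact measure_mono_null (subset_univ _) huniv
  set g : (∀ i, X i) → ℝ≥0∞ := Z.indicator 1 with hgdef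
  have hg : Measurable g := measurable_one.indicator hZ
  -- saturation of the indicator: Fubini along the fibre turns the dichotomy into pointwise invariance
  have hupd : ∀ (x : ∀ i, X i) (i : ι) (y y' : X i),
      Function.update (Function.update x i y) i y' = Function.update x i y' := fun x i y y' => Function.update_idem _ _ _
  have hsat' : ∀ i, ∀ᵐ x ∂Measure.pi μ, ∀ᵐ y ∂μ i, g (Function.update x i y) = g x := by
    intro i
    -- the two "bad" sets: fibre a.e. inside `Z` but the point outside, and vice versa
    have hmeas_in : Measurable fun x => lmarginal μ {i} (Zᶜ.indicator (1 : (∀ i, X i) → ℝ≥0∞)) x :=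
      (measurable_one.indicator hZ.compl).lmarginal μ
    have hmeas_out : Measurable fun x => lmarginal μ {i} (Z.indicator (1 : (∀ i, X i) → ℝ≥0∞)) x :=
      (measurable_one.indicator hZ).lmarginal μ
    -- `fibre a.e. in Z` ↔ the marginal of `1_{Zᶜ}` vanishes
    have hin_iff : ∀ x, (∀ᵐ y ∂μ i, Function.update x i y ∈ Z) ↔
        lmarginal μ {i} (Zᶜ.indicator (1 : (∀ i, X i) → ℝ≥0∞)) x = 0 := by
      intro x
      rw [lmarginal_singleton]
      have hm' : Measurable fun y => Zᶜ.indicator (1 : (∀ i, X i) → ℝ≥0∞) (Function.update x i y) :=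
        (measurable_one.indicator hZ.compl).comp (measurable_update _)
      rw [lintegral_eq_zero_iff hm']
      refine ⟨fun h => h.mono fun y hy => by simp [hy], fun h => h.mono fun y hy => ?_⟩
      by_contra hny
      simp [Set.indicator_of_mem (show Function.update x i y ∈ Zᶜ from hny)] at hy
    have hout_iff : ∀ x, (∀ᵐ y ∂μ i, Function.update x i y ∉ Z) ↔
        lmarginal μ {i} (Z.indicator (1 : (∀ i, X i) → ℝ≥0∞)) x = 0 := by
      intro x
      rw [lmarginal_singleton]
      have hm' : Measurable fun y => Z.indicator (1 : (∀ i, X i) → ℝ≥0∞) (Function.update x i y) :=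
        (measurable_one.indicator hZ).comp (measurable_update _)
      rw [lintegral_eq_zero_iff hm']
      refine ⟨fun h => h.mono fun y hy => by simp [hy], fun h => h.mono fun y hy => ?_⟩
      by_contra hny
      simp [Set.indicator_of_mem hny] at hy
    set Ein : Set (∀ i, X i) := {x | lmarginal μ {i} (Zᶜ.indicator (1 : (∀ i, X i) → ℝ≥0∞)) x = 0} ∩ Zᶜ with hEin
    set Eout : Set (∀ i, X i) := {x | lmarginal μ {i} (Z.indicator (1 : (∀ i, X i) → ℝ≥0∞)) x = 0} ∩ Z with hEout
    have hEin_m : MeasurableSet Ein := (hmeas_in (measurableSet_singleton 0)).inter hZ.compl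
    have hEout_m : MeasurableSet Eout := (hmeas_out (measurableSet_singleton 0)).inter hZ
    -- both bad sets are null: their fibre marginals vanish identically
    have hnull : ∀ (E : Set (∀ i, X i)), MeasurableSet E →
        (∀ x, lmarginal μ {i} (E.indicator (1 : (∀ i, X i) → ℝ≥0∞)) x = 0) → Measure.pi μ E = 0 := by
      intro E hE hfib
      have hEi : Measurable (E.indicator (1 : (∀ i, X i) → ℝ≥0∞)) := measurable_one.indicator hE
      have h := lintegral_lmarginal_singleton μ i hEi
      rw [lintegral_congr fun x => hfib x, lintegral_zero, lintegral_indicator_one hE] at h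
      have hi0 : μ i univ ≠ 0 := fun h' => h0 (Finset.prod_eq_zero (Finset.mem_univ i) h')
      exact (mul_eq_zero.1 h.symm).resolve_left hi0
    have hEin0 : Measure.pi μ Ein = 0 := by
      refine hnull Ein hEin_m fun x => ?_
      rw [lmarginal_singleton]
      have hm' : Measurable fun y => Ein.indicator (1 : (∀ i, X i) → ℝ≥0∞) (Function.update x i y) :=
        (measurable_one.indicator hEin_m).comp (measurable_update _)
      rw [lintegral_eq_zero_iff hm']
      by_cases hx : lmarginal μ {i} (Zᶜ.indicator (1 : (∀ i, X i) → ℝ≥0∞)) x = 0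
      · have hfx := (hin_iff x).2 hx
        filter_upwards [hfx] with y hy
        have : Function.update x i y ∉ Ein := fun hmem => hmem.2 hy
        simp [Set.indicator_of_notMem this]
      · refine Eventually.of_forall fun y => ?_
        have : Function.update x i y ∉ Ein := by
          intro hmem
          apply hx
          have h1 := hmem.1
          simp only [Set.mem_setOf_eq] at h1
          rwa [lmarginal_update_of_mem μ (Finset.mem_singleton_self i)] at h1
        simp [Set.indicator_of_notMem this]
    have hEout0 : Measure.pi μ Eout = 0 := by
      refine hnull Eout hEout_m fun x => ?_
      rw [lmarginal_singleton]
      have hm' : Measurable fun y => Eout.indicator (1 : (∀ i, X i) → ℝ≥0∞) (Function.update x i y) :=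
        (measurable_one.indicator hEout_m).comp (measurable_update _)
      rw [lintegral_eq_zero_iff hm']
      by_cases hx : lmarginal μ {i} (Z.indicator (1 : (∀ i, X i) → ℝ≥0∞)) x = 0
      · have hfx := (hout_iff x).2 hx
        filter_upwards [hfx] with y hy
        have : Function.update x i y ∉ Eout := fun hmem => hy hmem.2
        simp [Set.indicator_of_notMem this]
      · refine Eventually.of_forall fun y => ?_
        have : Function.update x i y ∉ Eout := by
          intro hmem
          apply hx
          have h1 := hmem.1
          simp only [Set.mem_setOf_eq] at h1
          rwa [lmarginal_update_of_mem μ (Finset.mem_singleton_self i)] at h1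
        simp [Set.indicator_of_notMem this]
    have haeE : ∀ᵐ x ∂Measure.pi μ, x ∉ Ein ∧ x ∉ Eout := by
      rw [ae_iff]
      refine measure_mono_null (fun x hx => ?_) (measure_union_null hEin0 hEout0)
      simp only [Set.mem_setOf_eq, not_and_or, not_not] at hx
      exact hx
    filter_upwards [hsat i, haeE] with x hx hxE
    rcases hx with hin | hout
    · have hxZ : x ∈ Z := by
        by_contra hxZ
        exact hxE.1 ⟨(hin_iff x).1 hin, hxZ⟩
      filter_upwards [hin] with y hy
      simp [hgdef, Set.indicator_of_mem hy, Set.indicator_of_mem hxZ]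
    · have hxZ : x ∉ Z := fun hxZ => hxE.2 ⟨(hout_iff x).1 hout, hxZ⟩
      filter_upwards [hout] with y hy
      simp [hgdef, Set.indicator_of_notMem hy, Set.indicator_of_notMem hxZ]
  -- the indicator is a.e. constant
  have hconst := ae_eq_const_of_saturated μ hg hsat' h0
  set c : ℝ≥0∞ := (∏ i, μ i univ)⁻¹ * ∫⁻ x, g x ∂Measure.pi μ with hc
  by_cases hZ0 : Measure.pi μ Z = 0
  · exact Or.inl hZ0
  · right
    -- some point of `Z` is typical, so `c = 1`, so `g = 1` a.e.
    have hex : ∃ x, x ∈ Z ∧ g x = c := by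
      by_contra hne
      push Not at hne
      apply hZ0
      refine measure_mono_null (fun x hx => ?_) (ae_iff.1 hconst)
      exact hne x hx
    obtain ⟨x₁, hx₁Z, hx₁⟩ := hex
    have hc1 : c = 1 := by rw [← hx₁]; simp [hgdef, Set.indicator_of_mem hx₁Z]
    rw [hc1] at hconst
    refine measure_mono_null (fun x hx => ?_) (ae_iff.1 hconst)
    intro hgx
    simp [hgdef, Set.indicator_of_notMem hx] at hgx

/-- **Cube saturation lemma, closed form** (registered sub-goal `cubeSaturation_c2` of the crux item; universe-monomorphic
restatement of `measure_eq_zero_or_compl_of_saturated`). [folklore] -/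
theorem cubeSaturation_c2 :
    ∀ {ι : Type} [Fintype ι] [DecidableEq ι] {X : ι → Type} [∀ i, MeasurableSpace (X i)] (μ : ∀ i, MeasureTheory.Measure (X i)) [∀ i, MeasureTheory.IsFiniteMeasure (μ i)] {Z : Set (∀ i, X i)}, MeasurableSet Z → (∀ i, ∀ᵐ x ∂MeasureTheory.Measure.pi μ, (∀ᵐ y ∂μ i, Function.update x i y ∈ Z) ∨ (∀ᵐ y ∂μ i, Function.update x i y ∉ Z)) → MeasureTheory.Measure.pi μ Z = 0 ∨ MeasureTheory.Measure.pi μ Zᶜ = 0 :=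
  fun μ _ _ hZ hsat => measure_eq_zero_or_compl_of_saturated μ hZ hsat

end CubeSaturation

end Summit.AtomisticToContinuum.BoseEinsteinCondensation.Cruxes.HardCoreExtension.ThirdLawCurrentFloorAlt

end
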